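import Summits.ValiantsHypothesis.ValiantsHypothesis.Theorems.LacunarySymmetroidMatrixDescartesNsdPivotSix

/-!
# `MatrixDescartes` (stmt-ValiantsHypothesis-18050) — even COMMUTING letters do not rescue `2n` under a negative-definite pivot:
# a `2 × 2` pencil with four DIAGONAL PSD letters, `J ≺ 0`, and exactly FIVE positive roots (`5 > 4 = 2n`)

HONEST FRAMING.  Cell `pub-symmetroid`, seat `val-sym-mdr-p2` (gen 11); helper file `--supports` the crux
`Theses.LacunarySymmetroid.MatrixDescartes` (OPEN), NO closure claim.  Sixth file of the session's NSD-pivot series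
(`…NsdPivotSix` refuted «`J ⪯ 0 ⇒ Z₊ ≤ 2n`» with non-commuting rank-one letters).  The two K-free `2 × 2` laws one might still
hope for after that — «pairwise COMMUTING PSD letters and `J ⪯ 0`» (the letters are then simultaneously diagonal, the pencil is
`diag(p, q) + X^e J` with positive-coefficient fewnomials `p`, `q`, and `det = (p − aX^e)(q − bX^e) − c²X^{2e}` with `c² ≤ ab`) —
is FALSE as well: the object below has diagonal letters, a negative-DEFINITE pivot (`det(−J) = 48 > 0`, `tr(−J) > 0`) and five
positive determinant roots.  (For comparison: diagonal letters with an INDEFINITE pivot give conjb-1's softmax staircase `2K − 3`,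
`…CensusPivotRankOne`; the present object shows the NSD constraint `c² ≤ ab` does not restore `2n`.)

THE OBJECT (integer pencil; pivot exponent `9`):
  `F(X) = diag(697·X¹⁰ + 631·X³⁹, 970 + 376·X¹²) − X⁹ · [[469, 638], [638, 868]]`,
  `det F(X) = X⁹ · (−454930 + 676090 X + 48 X⁹ − 604996 X¹⁰ − 176344 X¹² + 262072 X¹³ + 612070 X³⁰ − 547708 X³⁹ + 237256 X⁴²)`
(nine coefficients, FIVE sign changes — Descartes-sharp for its support), signs `− + − + − +` at `X = 57/100, 39/50, 47/50, 1, 6/5, 21/10`,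
so **`five_le_pivotPosRoots`** (exact count by Sturm, seat script: exactly 5) and **`not_commutingNsdPivotLaw_two`**:
`¬ (∀ K e d J P, J symmetric → −J ⪰ 0 → letters ⪰ 0 → letters pairwise commute → Z₊ ≤ 2·2)`.
MECHANISM (paper, memo NSD-PIVOT-COLUMN.md §6): with `g = p·X^{−e} − a`, `k = q·X^{−e} − b` (convex in `log X`) the zeros solve
`g k = c²`; on the «middle piece» (`g` increasing from `0`, `k` decreasing to `0`) the product has TWO humps (`13.15`, `18.07` in the
float model) with a valley (`13.09`) far below `ab = 53.8`, so a level `c² ∈ (13.09, 13.15)` — still `< ab`, i.e. NSD — is cut four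
times, and the right ray adds one.  Nothing here bears on `MatrixDescartes` in its window, on `DoorA26` / `DoorA34`, on the cell's
registers, or on `VP ≠ VNP`.

[folklore] Intermediate value theorem at rational points (`norm_num`) through `Pivot.le_pivotPosRoots_of_certificate`; the object is this
seat's (random middle-piece sampling → thin window → ES with frozen integer rates → exact re-verification).
-/

-- `Summit.ValiantsHypothesis.ValiantsHypothesis.…` repeats a component by the D-0017 layout
-- (single-conjunct summit), which the `dupNamespace` linter flags; the name is mandated.
set_option linter.dupNamespace false

namespace Summit.ValiantsHypothesis.ValiantsHypothesis.Theorems.LacunarySymmetroidMatrixDescartes.Pivot.NsdPivotCommutingFive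

open scoped BigOperators Matrix

/-- Closed form of `det F(t)` for the explicit diagonal-letter pencil (pivot `−[[469,638],[638,868]]` at exponent `9`; letters at
`10, 39, 0, 12`). The literals ARE the certificate's data. [folklore] -/
theorem eval_det (t : ℝ) :
    (t ^ 9 • (!![(-469 : ℝ), (-638 : ℝ); (-638 : ℝ), (-868 : ℝ)] : Matrix (Fin 2) (Fin 2) ℝ)
      + ∑ k, t ^ (![10, 39, 0, 12] : Fin 4 → ℕ) k •
        (![!![(697 : ℝ), 0; 0, 0], !![(631 : ℝ), 0; 0, 0], !![(0 : ℝ), 0; 0, 970], !![(0 : ℝ), 0; 0, 376]]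
          : Fin 4 → Matrix (Fin 2) (Fin 2) ℝ) k).det
      = -(454930 : ℝ) * t ^ 9 + (676090 : ℝ) * t ^ 10 + (48 : ℝ) * t ^ 18 - (604996 : ℝ) * t ^ 19 - (176344 : ℝ) * t ^ 21
          + (262072 : ℝ) * t ^ 22 + (612070 : ℝ) * t ^ 39 - (547708 : ℝ) * t ^ 48 + (237256 : ℝ) * t ^ 51 := by
  rw [Matrix.det_fin_two]
  simp [Matrix.add_apply, Fin.sum_univ_succ]
  ring

/-- The pivot letter is symmetric. [folklore] -/
theorem J_isSymm : (!![(-469 : ℝ), (-638 : ℝ); (-638 : ℝ), (-868 : ℝ)] : Matrix (Fin 2) (Fin 2) ℝ).IsSymm := by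
  unfold Matrix.IsSymm; ext i j; fin_cases i <;> fin_cases j <;> rfl

/-- The pivot letter is negative semidefinite: `−J = [[469,638],[638,868]]`, `638² = 407044 ≤ 469·868 = 407092`. [folklore] -/
theorem neg_J_posSemidef : (-(!![(-469 : ℝ), (-638 : ℝ); (-638 : ℝ), (-868 : ℝ)] : Matrix (Fin 2) (Fin 2) ℝ)).PosSemidef := by
  have h : -(!![(-469 : ℝ), (-638 : ℝ); (-638 : ℝ), (-868 : ℝ)] : Matrix (Fin 2) (Fin 2) ℝ) = !![(469 : ℝ), 638; 638, 868] := by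
    ext i j; fin_cases i <;> fin_cases j <;> simp
  rw [h]
  exact PivotTwoFourWitness.posSemidef_two_of_entries _ _ _ (by norm_num) (by norm_num) (by norm_num)

/-- The pivot letter is even negative DEFINITE in the sense `det J > 0` and `tr J < 0` (both eigenvalues negative). [folklore] -/
theorem J_det_pos_trace_neg :
    0 < (!![(-469 : ℝ), (-638 : ℝ); (-638 : ℝ), (-868 : ℝ)] : Matrix (Fin 2) (Fin 2) ℝ).det
      ∧ (!![(-469 : ℝ), (-638 : ℝ); (-638 : ℝ), (-868 : ℝ)] : Matrix (Fin 2) (Fin 2) ℝ).trace < 0 := by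
  rw [Matrix.det_fin_two, Matrix.trace_fin_two]; simp; norm_num

/-- The four letters are positive semidefinite (diagonal with non-negative entries). [folklore] -/
theorem P_posSemidef : ∀ k : Fin 4,
    ((![!![(697 : ℝ), 0; 0, 0], !![(631 : ℝ), 0; 0, 0], !![(0 : ℝ), 0; 0, 970], !![(0 : ℝ), 0; 0, 376]]
          : Fin 4 → Matrix (Fin 2) (Fin 2) ℝ) k).PosSemidef := by
  intro k
  fin_cases k
  · exact PivotTwoFourWitness.posSemidef_two_of_entries _ _ _ (by norm_num) (by norm_num) (by norm_num)
  · exact PivotTwoFourWitness.posSemidef_two_of_entries _ _ _ (by norm_num) (by norm_num) (by norm_num)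
  · exact PivotTwoFourWitness.posSemidef_two_of_entries _ _ _ (by norm_num) (by norm_num) (by norm_num)
  · exact PivotTwoFourWitness.posSemidef_two_of_entries _ _ _ (by norm_num) (by norm_num) (by norm_num)

/-- The four letters pairwise COMMUTE (they are diagonal). [folklore] -/
theorem P_commute : ∀ k l : Fin 4,
    Commute ((![!![(697 : ℝ), 0; 0, 0], !![(631 : ℝ), 0; 0, 0], !![(0 : ℝ), 0; 0, 970], !![(0 : ℝ), 0; 0, 376]]
          : Fin 4 → Matrix (Fin 2) (Fin 2) ℝ) k)
      ((![!![(697 : ℝ), 0; 0, 0], !![(631 : ℝ), 0; 0, 0], !![(0 : ℝ), 0; 0, 970], !![(0 : ℝ), 0; 0, 376]]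
          : Fin 4 → Matrix (Fin 2) (Fin 2) ℝ) l) := by
  intro k l
  fin_cases k <;> fin_cases l <;>
    (unfold Commute SemiconjBy; ext i j; fin_cases i <;> fin_cases j <;> simp [Matrix.mul_apply] <;> norm_num)

/-- **`Z₊ ≥ 5`**: `det F` alternates `− + − + − +` along six increasing positive rationals. [folklore] -/
theorem five_le_pivotPosRoots :
    5 ≤ pivotPosRoots 9 (![10, 39, 0, 12] : Fin 4 → ℕ) (!![(-469 : ℝ), (-638 : ℝ); (-638 : ℝ), (-868 : ℝ)] : Matrix (Fin 2) (Fin 2) ℝ)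
      (![!![(697 : ℝ), 0; 0, 0], !![(631 : ℝ), 0; 0, 0], !![(0 : ℝ), 0; 0, 970], !![(0 : ℝ), 0; 0, 376]]
          : Fin 4 → Matrix (Fin 2) (Fin 2) ℝ) :=
  le_pivotPosRoots_of_certificate (N := 5) eval_det
    ![57 / 100, 39 / 50, 47 / 50, 1, 6 / 5, 21 / 10]
    (by
      refine Fin.strictMono_iff_lt_succ.2 fun j => ?_
      fin_cases j <;> simp only [Fin.castSucc_mk, Fin.succ_mk] <;> norm_num)
    (by intro j; fin_cases j <;> norm_num)
    (by intro j; fin_cases j <;> simp only [Fin.castSucc_mk, Fin.succ_mk] <;> norm_num)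

/-- **COMMUTING letters + NSD pivot is NOT a `2n` law at `n = 2`**: it is not the case that every `2 × 2` pivot pencil with a negative
semidefinite pivot letter and pairwise commuting positive semidefinite letters has at most `2·2` distinct positive determinant zeros.
[folklore] -/
theorem not_commutingNsdPivotLaw_two :
    ¬ (∀ (K e : ℕ) (d : Fin K → ℕ) (J : Matrix (Fin 2) (Fin 2) ℝ) (P : Fin K → Matrix (Fin 2) (Fin 2) ℝ),
        J.IsSymm → (-J).PosSemidef → (∀ k, (P k).PosSemidef) → (∀ k l, Commute (P k) (P l)) →
          pivotPosRoots e d J P ≤ 2 * 2) := by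
  intro h
  exact absurd (le_trans five_le_pivotPosRoots (h 4 9 _ _ _ J_isSymm neg_J_posSemidef P_posSemidef P_commute)) (by norm_num)

end Summit.ValiantsHypothesis.ValiantsHypothesis.Theorems.LacunarySymmetroidMatrixDescartes.Pivot.NsdPivotCommutingFive
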